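import Literature.MathematicalPhysics.QuantumFieldTheory.Balaban1983to89.B1Ineq368BoxBound
import Literature.MathematicalPhysics.QuantumFieldTheory.Balaban1983to89.B1Eq353SupNorm

/-!
# `Balaban1983to89.B1Ineq367SmallField` — T. Bałaban, *(Higgs)₂,₃ quantum fields in a finite volume. I. A lower bound*,
# Commun. Math. Phys. **85** (1982) 603–626 [Balaban1982Higgs1]: the replacement of **(3.67)** p. 625 — *"Further we can
# estimate χ_K(A)χ_K(φ) ≧ Π_{x∈T^{(K)}_{L^Kε}} χ({|A(x)| ≦ c₁⁻¹(L^Kε)^{−(d−2)/2}p(L^Kε)})·χ({|φ(x)| ≦ c₁⁻¹(L^Kε)^{−(d−2)/2}p(L^Kε)})"* —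
# i.e. `χ_K = 1` on the small-field set, FOR THE CONCRETE (Higgs)₂,₃ MODEL: the displayed input (E3) of this seat's per-lattice
# assembly (`B1Ineq368BoxBound.ineq368_model`/`lowerBound_model`, `B1LowerBound114Model.Inputs.hE3`) DERIVED from the
# (2.25)-shaped sup bounds of the two level-`K` propagators (Prop. 2.1, row B1.Prop2.1), and PROVED OUTRIGHT at `K = 0`

statement-level skeleton of published theorems with citation tags; proofs where landed; nothing here is a claim about the Yang–Mills mass gap

PDF held: `paper:balaban1982-cmp85-higgs23-i` (journal page = PDF page + 602); p. 625 [PDF 23] ((3.67)), p. 617 [PDF 15]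
((3.27)–(3.29)), p. 613 [PDF 11] ((3.1)–(3.2)), p. 610 [PDF 8] ((2.20), (2.25)); ×2 renders
`run/shared/lean/pub/pub-balaban/b2b-balaban-ref1/pages/1982-cmp85-higgs23-I/1982-cmp85-higgs23-I-p023|p015|p011|p008-x2.png`.

CITATION HEADER (lean-in-tree rule).  Cell `lit-balaban` (HOME `run/shared/lean/pub/lit-balaban/`), Phase-2 proof seat **p14**
gen 8 (unit `lit-balaban-p14`); SKELETON rows **B1.Eq3.66-3.67** (r12; (3.67) the χ-replacement), **B1.Eq3.27-3.28**,
**B1.Eq3.1-3.2** (r14; the restrictions, typer's concrete `B1Eq31Concrete.chiKA/chiKφ/chi0A/chi0φ`), **B1.Thm@606** (the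
(E3) field of `B1LowerBound114Model.Inputs`, this seat gen 7).  USED BY NAME, never restated: `B1Ineq326HiggsModel.chiW`
(the cut-off weight of record), `B1Ineq368BoxBound.smallSet` (the set `S_r` of (3.67)), `B1Eq31Concrete.{chiSmall_eq_one_iff,
toSite_bgVec, bgScalar, negLap, covLaplacianN_univ_apply, negLap_apply}` (typer), this seat's schematic `B1Ineq367Proof.chiK_of_small`
(gen 3) and concrete `B1Eq353SupNorm.{norm_bgScalar_le, norm_covLaplacianN_bgScalar_le}` (gen 8).

WHAT IS PRINTED (verbatim, p. 625 [PDF 23]): *"Further we can estimate χ_K(A)χ_K(φ) ≧ Π_{x∈T^{(K)}_{L^Kε}} χ({|A(x)| ≦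
c₁⁻¹(L^Kε)^{−(d−2)/2}p(L^Kε)})·χ({|φ(x)| ≦ c₁⁻¹(L^Kε)^{−(d−2)/2}p(L^Kε)}) and we get Z^ε ≧ ∫dA∫dφ Π_{x}χ(…)χ(…) Z_KZ_K(0)exp[…].
(3.67)"* with (3.27)–(3.28) p. 617: *"χ_k(A) = Π_{x∈T_ε}χ({|A^{(k),ε}(x)| ≦ (L^kε)^{−(d−2)/2}p(L^kε)})χ({|(Δ^εA^{(k),ε})(x)| ≦
(L^kε)^{−(d+2)/2}p(L^kε)}) (3.27) [… χ_k(φ) the same with φ^{(k),ε}, Δ^ε_{A^{(k),ε}} (3.28)]"*, (3.29): *"A^{(k),ε} =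
a_k(L^kε)^{−2}G^ε_kQ^*_kA, φ^{(k),ε} = a_k(L^kε)^{−2}G^ε_k(A^{(k),ε})Q^*_k(A^{(k),ε})φ"*.

THE READING.  `χ_K(A)χ_K(φ) ≧ 𝟙_{S_r}`, `S_r = {|A(x)| ≦ r, |φ(x)| ≦ r ∀x}`, `r = c₁⁻¹(L^Kε)^{−(d−2)/2}p(L^Kε)`, means: on `S_r`
the four restrictions of (3.27)–(3.28) hold.  By (3.29) the background fields are `a_Kℓ^{−2}G Q^*` images of `A`, `φ`
(`ℓ = L^Kε`), so this is the sup-norm boundedness of `a_Kℓ^{−2}G^ε_KQ_K^*` (constant `≦ c₁`) and of `Δ∘a_Kℓ^{−2}G^ε_KQ_K^*`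
(constant `≦ c₁ℓ^{−2}`) — for the VECTOR propagator `G^ε_K` (zero external field, mass `μ₀²`) and for the SCALAR one
`G^ε_K(A^{(K),ε})` (covariant, mass `m²`) — which `B1Eq353SupNorm` derives from the (2.25)-shaped bound `‖G^ε_Kg‖_∞ ≦
c₀ℓ²‖g‖_∞` and (2.20).  The constant `c₁` of (3.67) is thus any `c₁ ≧ a_K(c₀ + 1 + max{μ₀², m²}c₀ℓ² + a_Kc₀)`.  At `K = 0` no
propagator occurs (`χ₀` restricts `A`, `φ` themselves, (3.1)–(3.2)) and `|(Δ^εA)(x)|, |(Δ^ε_Aφ)(x)| ≦ 4dε^{−2}r` on `S_r`: (3.67)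
holds with `c₁ = 4d`, unconditionally.

WHAT THIS FILE PROVES (kernel-checked, zero `sorry`, NO new `def`, no new `Prop` fact; axioms standard).
* §1 `norm_negLap_apply_le`, `norm_covLaplacianN_univ_apply_le`: `|(Δ^εF)(x)|, |(Δ^ε_Aφ)(x)| ≦ 4dε^{−2}·sup|·|` (every `A`: unitary
  transports); **`chiW_zero_eq_one_of_smallSet`**: (E3) AT `K = 0` for the model, HYPOTHESIS-FREE (`4d·r ≦ ε^{−(d−2)/2}p₀`).
* §2 `hreg_vec` / `hreg_scalar`: the `hreg` input of `B1Ineq367Proof.chiK_of_small` for the two concrete background maps (3.29)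
  from the (2.25)-shaped sup bounds (via `B1Eq353SupNorm`); `chiKA_eq_one_of_small`, `chiKφ_eq_one_of_small`; and
  **`chiW_eq_one_of_smallSet`**: (E3) AT `K ≧ 1` — `∀ ω ∈ S_r, χ_K(ω) = 1` with thresholds `ℓ_K = L^Kε`, `p_K ≧ 0`, radius
  `r ≦ c₁⁻¹(L^Kε)^{−(d−2)/2}p_K`, GIVEN the two sup bounds (`hGv`, `hGs` — row B1.Prop2.1 at level `K`, displayed); the shape is
  the field `hE3` of `B1LowerBound114Model.Inputs` verbatim.
HONEST SCOPE: the (2.25) bounds for `G^ε_K` (vector, `A = 0` on the torus) and for `G^ε_K(A^{(K),ε})` (scalar, regular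
background) are INPUTS here (displayed hypotheses), proved in the tree only at zero field on nested boxes (B4 sub-cell); the
`K = 0` theorem has no input.  Unit `lit-balaban-p14` gen 8 (literature-prover-lit-balaban-p14-g8-0).
-/

open scoped BigOperators

namespace Literature.MathematicalPhysics.QuantumFieldTheory.Balaban1983to89.B1Ineq367SmallField

open Literature.MathematicalPhysics.QuantumFieldTheory.Balaban1983to89.HiggsLattice
open Literature.MathematicalPhysics.QuantumFieldTheory.Balaban1983to89.HiggsCovariance
open Literature.MathematicalPhysics.QuantumFieldTheory.Balaban1983to89.B3MultiscaleFields (toSite zeroCharge zeroCharge_U)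
open Literature.MathematicalPhysics.QuantumFieldTheory.Balaban1983to89.B1Eq31Concrete (chiSmall thrF thrLap chi0A chi0φ chiKA
  chiKφ bgVec bgScalar negLap chiSmall_eq_one_iff toSite_bgVec covLaplacianN_univ_apply negLap_apply)
open Literature.MathematicalPhysics.QuantumFieldTheory.Balaban1983to89.B1Ineq326HiggsModel (chiW)
open Literature.MathematicalPhysics.QuantumFieldTheory.Balaban1983to89.B1Ineq368BoxBound (smallSet)
open Literature.MathematicalPhysics.QuantumFieldTheory.Balaban1983to89.B1Eq353SupNorm (norm_bgScalar_le
  norm_covLaplacianN_bgScalar_le thrLap_eq_inv_sq_mul_thrF)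
open Literature.MathematicalPhysics.QuantumFieldTheory.Balaban1983to89.B1LowerBound (bgField SmallFieldAt)

variable {P : Params} {N : ℕ}

/-! ## §1 `K = 0`: (3.67) for the restrictions (3.1)–(3.2) of the fields themselves — unconditional -/

section LevelZero

variable {k : ℕ}

/-- **`|(Δ^ηF)(x)| ≦ 4dη^{−2}·sup|F|`** for the Laplace operator on `ℝ^d`-valued site functions ((1.11): each of the `2d`
neighbour differences is at most `2·sup|F|`). [cite: Balaban1982Higgs1, (1.11) p.605] -/
theorem norm_negLap_apply_le (F : ScalarField P k P.d) {M : ℝ} (hF : ∀ x, ‖F x‖ ≤ M) (x : Site P k) :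
    ‖negLap F x‖ ≤ 4 * P.d * ((P.mesh k)⁻¹ ^ 2) * M := by
  rw [negLap_apply, norm_smul, Real.norm_of_nonneg (pow_nonneg (inv_nonneg.2 (P.mesh_pos k).le) 2)]
  have hsum : ‖∑ μ : Fin P.d, ((F x - F (x.shift μ)) + (F x - F (x.unshift μ)))‖ ≤ P.d * (4 * M) := by
    calc ‖∑ μ : Fin P.d, ((F x - F (x.shift μ)) + (F x - F (x.unshift μ)))‖
        ≤ ∑ μ : Fin P.d, ‖(F x - F (x.shift μ)) + (F x - F (x.unshift μ))‖ := norm_sum_le _ _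
      _ ≤ ∑ _μ : Fin P.d, 4 * M := Finset.sum_le_sum fun μ _ => by
          calc ‖(F x - F (x.shift μ)) + (F x - F (x.unshift μ))‖
              ≤ (‖F x‖ + ‖F (x.shift μ)‖) + (‖F x‖ + ‖F (x.unshift μ)‖) :=
                (norm_add_le _ _).trans (add_le_add (norm_sub_le _ _) (norm_sub_le _ _))
            _ ≤ (M + M) + (M + M) := add_le_add (add_le_add (hF _) (hF _)) (add_le_add (hF _) (hF _))
            _ = 4 * M := by ring
      _ = P.d * (4 * M) := by rw [Finset.sum_const, Finset.card_univ, Fintype.card_fin, nsmul_eq_mul]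
  calc (P.mesh k)⁻¹ ^ 2 * ‖∑ μ : Fin P.d, ((F x - F (x.shift μ)) + (F x - F (x.unshift μ)))‖
      ≤ (P.mesh k)⁻¹ ^ 2 * (P.d * (4 * M)) :=
        mul_le_mul_of_nonneg_left hsum (pow_nonneg (inv_nonneg.2 (P.mesh_pos k).le) 2)
    _ = 4 * P.d * ((P.mesh k)⁻¹ ^ 2) * M := by ring

/-- **`|(Δ^η_Aφ)(x)| ≦ 4dη^{−2}·sup|φ|`** for the covariant Laplace operator on the whole torus, EVERY vector field `A`
(the transports `U(±A_b)` are unitary, p. 605). [cite: Balaban1982Higgs1, (1.11) p.605] -/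
theorem norm_covLaplacianN_univ_apply_le (C : ChargeData N) (A : VecField P k) (φ : ScalarField P k N) {M : ℝ}
    (hφ : ∀ x, ‖φ x‖ ≤ M) (x : Site P k) :
    ‖covLaplacianN C Finset.univ A φ x‖ ≤ 4 * P.d * ((P.mesh k)⁻¹ ^ 2) * M := by
  rw [covLaplacianN_univ_apply, norm_smul, Real.norm_of_nonneg (pow_nonneg (inv_nonneg.2 (P.mesh_pos k).le) 2)]
  have hU : ∀ (t : ℝ) (v : EuclideanSpace ℝ (Fin N)), ‖C.U (P.mesh k) t v‖ = ‖v‖ := fun t v =>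
    ContinuousLinearMap.norm_map_of_mem_unitary (C.U_mem_unitary _ _) v
  have hsum : ‖∑ μ : Fin P.d, ((φ x - C.U (P.mesh k) (A ⟨x, μ⟩) (φ (x.shift μ)))
      + (φ x - C.U (P.mesh k) (-(A ⟨x.unshift μ, μ⟩)) (φ (x.unshift μ))))‖ ≤ P.d * (4 * M) := by
    calc ‖∑ μ : Fin P.d, ((φ x - C.U (P.mesh k) (A ⟨x, μ⟩) (φ (x.shift μ)))
            + (φ x - C.U (P.mesh k) (-(A ⟨x.unshift μ, μ⟩)) (φ (x.unshift μ))))‖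
        ≤ ∑ μ : Fin P.d, ‖(φ x - C.U (P.mesh k) (A ⟨x, μ⟩) (φ (x.shift μ)))
            + (φ x - C.U (P.mesh k) (-(A ⟨x.unshift μ, μ⟩)) (φ (x.unshift μ)))‖ := norm_sum_le _ _
      _ ≤ ∑ _μ : Fin P.d, 4 * M := Finset.sum_le_sum fun μ _ => by
          calc ‖(φ x - C.U (P.mesh k) (A ⟨x, μ⟩) (φ (x.shift μ)))
                + (φ x - C.U (P.mesh k) (-(A ⟨x.unshift μ, μ⟩)) (φ (x.unshift μ)))‖
              ≤ (‖φ x‖ + ‖C.U (P.mesh k) (A ⟨x, μ⟩) (φ (x.shift μ))‖)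
                  + (‖φ x‖ + ‖C.U (P.mesh k) (-(A ⟨x.unshift μ, μ⟩)) (φ (x.unshift μ))‖) :=
                (norm_add_le _ _).trans (add_le_add (norm_sub_le _ _) (norm_sub_le _ _))
            _ ≤ (M + M) + (M + M) := by
                rw [hU, hU]
                exact add_le_add (add_le_add (hφ _) (hφ _)) (add_le_add (hφ _) (hφ _))
            _ = 4 * M := by ring
      _ = P.d * (4 * M) := by rw [Finset.sum_const, Finset.card_univ, Fintype.card_fin, nsmul_eq_mul]
  calc (P.mesh k)⁻¹ ^ 2 * ‖∑ μ : Fin P.d, ((φ x - C.U (P.mesh k) (A ⟨x, μ⟩) (φ (x.shift μ)))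
          + (φ x - C.U (P.mesh k) (-(A ⟨x.unshift μ, μ⟩)) (φ (x.unshift μ))))‖
      ≤ (P.mesh k)⁻¹ ^ 2 * (P.d * (4 * M)) :=
        mul_le_mul_of_nonneg_left hsum (pow_nonneg (inv_nonneg.2 (P.mesh_pos k).le) 2)
    _ = 4 * P.d * ((P.mesh k)⁻¹ ^ 2) * M := by ring

/-- The two restrictions of (3.1)/(3.2)-shape at scale `ℓ`, value `p`, hold for a site function with `sup|F| ≦ r` and
`sup|ΔF| ≦ 4dℓ^{−2}r` once `4d·r ≦ ℓ^{−(d−2)/2}p` (`d ≧ 1`). [cite: Balaban1982Higgs1, (3.1) p.613] -/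
theorem smallFieldAt_of_le {d : ℕ} (hd : 1 ≤ d) {ℓ p r nF nL : ℝ} (hℓ : 0 < ℓ) (hr0 : 0 ≤ r)
    (hr : 4 * d * r ≤ thrF d ℓ p) (hF : nF ≤ r) (hL : nL ≤ 4 * d * ((ℓ⁻¹) ^ 2) * r) :
    SmallFieldAt d ℓ p nF nL := by
  have hd' : (1 : ℝ) ≤ 4 * d := by
    have : (1 : ℝ) ≤ d := by exact_mod_cast hd
    linarith
  refine ⟨?_, ?_⟩
  · show nF ≤ thrF d ℓ p
    exact hF.trans ((le_mul_of_one_le_left hr0 hd').trans hr)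
  · show nL ≤ thrLap d ℓ p
    rw [thrLap_eq_inv_sq_mul_thrF d hℓ p]
    calc nL ≤ 4 * d * ((ℓ⁻¹) ^ 2) * r := hL
      _ = (ℓ ^ 2)⁻¹ * (4 * d * r) := by rw [inv_pow]; ring
      _ ≤ (ℓ ^ 2)⁻¹ * thrF d ℓ p := mul_le_mul_of_nonneg_left hr (inv_nonneg.2 (pow_nonneg hℓ.le 2))

/-- **(3.67) AT `K = 0`, UNCONDITIONALLY**: with the thresholds `ℓ₀ = ε`, `p₀` of `χ₀(A)χ₀(φ)` ((3.1)–(3.2): the fields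
themselves and their Laplacians `Δ^ε`, `Δ^ε_A`), every `(A, φ)` with `|A(x)|, |φ(x)| ≦ r` at every site, `4d·r ≦ ε^{−(d−2)/2}p₀`,
has `χ₀(A)χ₀(φ) = 1` — the field `hE3` of `B1LowerBound114Model.Inputs` at `K = 0` for the model, no input.
[cite: Balaban1982Higgs1, (3.67) p.625; (3.1)–(3.2) p.613] -/
theorem chiW_zero_eq_one_of_smallSet (C : ChargeData N) (ℓ p : ℕ → ℝ) (mu0sq msq a : ℝ) (hℓ0 : ℓ 0 = P.mesh 0) {r : ℝ}
    (hr : 4 * P.d * r ≤ thrF P.d (P.mesh 0) (p 0)) :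
    ∀ ω ∈ smallSet P N 0 r, chiW C ℓ p mu0sq msq a 0 ω.1 ω.2 = 1 := by
  rintro ⟨A, φ⟩ ⟨hA, hφ⟩
  have hε : 0 < P.mesh 0 := P.mesh_pos 0
  have hr0 : 0 ≤ r := (norm_nonneg _).trans (hA default)
  show chi0A (ℓ 0) (p 0) A * chi0φ C (ℓ 0) (p 0) A φ = 1
  rw [hℓ0]
  have h1 : chi0A (P.mesh 0) (p 0) A = 1 :=
    (chiSmall_eq_one_iff _ _ _ _ _).2 fun x => smallFieldAt_of_le P.hd hε hr0 hr (hA x)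
      (norm_negLap_apply_le (toSite A) hA x)
  have h2 : chi0φ C (P.mesh 0) (p 0) A φ = 1 :=
    (chiSmall_eq_one_iff _ _ _ _ _).2 fun x => smallFieldAt_of_le P.hd hε hr0 hr (hφ x)
      (norm_covLaplacianN_univ_apply_le C A φ hφ x)
  rw [h1, h2, mul_one]

end LevelZero

/-! ## §2 `K ≧ 1`: (3.67) from the (2.25)-shaped sup bounds of the two level-`K` propagators -/

section LevelK

variable (C : ChargeData N) {K : ℕ} {mu0sq msq a c₀ c₁ : ℝ}

/-- **The `hreg` input of `B1Ineq367Proof.chiK_of_small` for the VECTOR background map (3.29)** `A ↦ A^{(K),ε} =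
a_K(L^Kε)^{−2}G^ε_KQ_K^*A` (read on `ℝ^d`-valued site functions: `toSite A^{(K),ε} = bgField a_K ℓ G^ε_K Q_K^* (toSite A)`,
`G^ε_K`, `Q_K^*` at the trivial coupling `zeroCharge d`, external field `0`, mass `μ₀²`), from the (2.25)-shaped bound `hGv` and
(2.20) (`B1Eq353SupNorm`): constants `c₁` for the field and `c₁ℓ^{−2}` for `Δ^ε`, any `c₁ ≧ a_K(c₀ + 1 + μ₀²c₀ℓ² + a_Kc₀)`.
[cite: Balaban1982Higgs1, (3.29), (3.27) p.617; (2.25), (2.20) p.610] -/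
theorem hreg_vec (hK : K ≤ P.K) (hmu : 0 < mu0sq) (hak : 0 ≤ B1.aSeq a P.L K) (hc₀ : 0 ≤ c₀)
    (hc₁ : B1.aSeq a P.L K * (c₀ + 1 + mu0sq * c₀ * P.mesh K ^ 2 + B1.aSeq a P.L K * c₀) ≤ c₁)
    (hGv : ∀ (g : ScalarField P 0 P.d) (M : ℝ), (∀ x, ‖g x‖ ≤ M) →
      ∀ x, ‖propagatorK (zeroCharge P.d) Finset.univ (0 : VecField P 0) mu0sq a K g x‖ ≤ c₀ * P.mesh K ^ 2 * M) :
    ∀ (F : ScalarField P K P.d) (M : ℝ), (∀ y, ‖F y‖ ≤ M) → ∀ z,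
      ‖bgField (B1.aSeq a P.L K) (P.mesh K) (propagatorK (zeroCharge P.d) Finset.univ (0 : VecField P 0) mu0sq a K)
          (avgQkAdj (zeroCharge P.d) (0 : VecField P 0) K) F z‖ ≤ c₁ * M ∧
      ‖covLaplacianN (zeroCharge P.d) Finset.univ (0 : VecField P 0)
          (bgField (B1.aSeq a P.L K) (P.mesh K) (propagatorK (zeroCharge P.d) Finset.univ (0 : VecField P 0) mu0sq a K)
            (avgQkAdj (zeroCharge P.d) (0 : VecField P 0) K) F) z‖ ≤ c₁ * (P.mesh K ^ 2)⁻¹ * M := by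
  intro F M hF z
  have hM : 0 ≤ M := (norm_nonneg _).trans (hF default)
  have h1 := norm_bgScalar_le (zeroCharge P.d) (0 : VecField P 0) (msq := mu0sq) a hak hGv F hF z
  have h2 := norm_covLaplacianN_bgScalar_le (zeroCharge P.d) (0 : VecField P 0) hK hmu a hak hGv F hF z
  have hx1 : 0 ≤ mu0sq * c₀ * P.mesh K ^ 2 := mul_nonneg (mul_nonneg hmu.le hc₀) (sq_nonneg _)
  have hx2 : 0 ≤ B1.aSeq a P.L K * c₀ := mul_nonneg hak hc₀
  have hlow1 : B1.aSeq a P.L K * c₀ ≤ c₁ :=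
    (mul_le_mul_of_nonneg_left (show c₀ ≤ c₀ + 1 + mu0sq * c₀ * P.mesh K ^ 2 + B1.aSeq a P.L K * c₀ by linarith)
      hak).trans hc₁
  have hlow2 : B1.aSeq a P.L K * (1 + mu0sq * c₀ * P.mesh K ^ 2 + B1.aSeq a P.L K * c₀) ≤ c₁ :=
    (mul_le_mul_of_nonneg_left (show 1 + mu0sq * c₀ * P.mesh K ^ 2 + B1.aSeq a P.L K * c₀
      ≤ c₀ + 1 + mu0sq * c₀ * P.mesh K ^ 2 + B1.aSeq a P.L K * c₀ by linarith) hak).trans hc₁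
  refine ⟨h1.trans (mul_le_mul_of_nonneg_right hlow1 hM), h2.trans ?_⟩
  have hinv : 0 ≤ (P.mesh K ^ 2)⁻¹ := inv_nonneg.2 (pow_nonneg (P.mesh_pos K).le 2)
  calc B1.aSeq a P.L K * (P.mesh K ^ 2)⁻¹ * (1 + mu0sq * c₀ * P.mesh K ^ 2 + B1.aSeq a P.L K * c₀) * M
      = (B1.aSeq a P.L K * (1 + mu0sq * c₀ * P.mesh K ^ 2 + B1.aSeq a P.L K * c₀)) * (P.mesh K ^ 2)⁻¹ * M := by ring
    _ ≤ c₁ * (P.mesh K ^ 2)⁻¹ * M := mul_le_mul_of_nonneg_right (mul_le_mul_of_nonneg_right hlow2 hinv) hM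

/-- **The `hreg` input for the SCALAR background map (3.29)** `φ ↦ φ^{(K),ε} = a_K(L^Kε)^{−2}G^ε_K(Ã)Q_K^*(Ã)φ` in a background
`Ã` (`B1Eq31Concrete.bgScalar C m² a K Ã = bgField a_K ℓ G^ε_K(Ã) Q_K^*(Ã)`), with the covariant Laplacian `Δ^ε_{Ã}`, from the
(2.25)-shaped bound `hGs` for `G^ε_K(T_ε, Ã)` and (2.20): any `c₁ ≧ a_K(c₀ + 1 + m²c₀ℓ² + a_Kc₀)`.
[cite: Balaban1982Higgs1, (3.29), (3.28) p.617; (2.25), (2.20) p.610] -/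
theorem hreg_scalar (Abg : VecField P 0) (hK : K ≤ P.K) (hmsq : 0 < msq) (hak : 0 ≤ B1.aSeq a P.L K) (hc₀ : 0 ≤ c₀)
    (hc₁ : B1.aSeq a P.L K * (c₀ + 1 + msq * c₀ * P.mesh K ^ 2 + B1.aSeq a P.L K * c₀) ≤ c₁)
    (hGs : ∀ (g : ScalarField P 0 N) (M : ℝ), (∀ x, ‖g x‖ ≤ M) →
      ∀ x, ‖propagatorK C Finset.univ Abg msq a K g x‖ ≤ c₀ * P.mesh K ^ 2 * M) :
    ∀ (φ : ScalarField P K N) (M : ℝ), (∀ y, ‖φ y‖ ≤ M) → ∀ z,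
      ‖bgField (B1.aSeq a P.L K) (P.mesh K) (propagatorK C Finset.univ Abg msq a K) (avgQkAdj C Abg K) φ z‖ ≤ c₁ * M ∧
      ‖covLaplacianN C Finset.univ Abg
          (bgField (B1.aSeq a P.L K) (P.mesh K) (propagatorK C Finset.univ Abg msq a K) (avgQkAdj C Abg K) φ) z‖
        ≤ c₁ * (P.mesh K ^ 2)⁻¹ * M := by
  intro φ M hφ z
  have hM : 0 ≤ M := (norm_nonneg _).trans (hφ default)
  have h1 := norm_bgScalar_le C Abg (msq := msq) a hak hGs φ hφ z
  have h2 := norm_covLaplacianN_bgScalar_le C Abg hK hmsq a hak hGs φ hφ z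
  have hx1 : 0 ≤ msq * c₀ * P.mesh K ^ 2 := mul_nonneg (mul_nonneg hmsq.le hc₀) (sq_nonneg _)
  have hx2 : 0 ≤ B1.aSeq a P.L K * c₀ := mul_nonneg hak hc₀
  have hlow1 : B1.aSeq a P.L K * c₀ ≤ c₁ :=
    (mul_le_mul_of_nonneg_left (show c₀ ≤ c₀ + 1 + msq * c₀ * P.mesh K ^ 2 + B1.aSeq a P.L K * c₀ by linarith)
      hak).trans hc₁
  have hlow2 : B1.aSeq a P.L K * (1 + msq * c₀ * P.mesh K ^ 2 + B1.aSeq a P.L K * c₀) ≤ c₁ :=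
    (mul_le_mul_of_nonneg_left (show 1 + msq * c₀ * P.mesh K ^ 2 + B1.aSeq a P.L K * c₀
      ≤ c₀ + 1 + msq * c₀ * P.mesh K ^ 2 + B1.aSeq a P.L K * c₀ by linarith) hak).trans hc₁
  refine ⟨h1.trans (mul_le_mul_of_nonneg_right hlow1 hM), h2.trans ?_⟩
  have hinv : 0 ≤ (P.mesh K ^ 2)⁻¹ := inv_nonneg.2 (pow_nonneg (P.mesh_pos K).le 2)
  calc B1.aSeq a P.L K * (P.mesh K ^ 2)⁻¹ * (1 + msq * c₀ * P.mesh K ^ 2 + B1.aSeq a P.L K * c₀) * M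
      = (B1.aSeq a P.L K * (1 + msq * c₀ * P.mesh K ^ 2 + B1.aSeq a P.L K * c₀)) * (P.mesh K ^ 2)⁻¹ * M := by ring
    _ ≤ c₁ * (P.mesh K ^ 2)⁻¹ * M := mul_le_mul_of_nonneg_right (mul_le_mul_of_nonneg_right hlow2 hinv) hM

/-- **`χ_K(A) = 1` on the small-field set** ((3.27) for the vector background field): if `|A(x)| ≦ c₁⁻¹ℓ^{−(d−2)/2}p` at every
site, `ℓ = L^Kε`, `c₁` as in `hreg_vec`, then `χ_K(A) = 1` (`B1Eq31Concrete.chiKA` at scale `ℓ`, value `p`), GIVEN the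
(2.25)-shaped bound for the vector propagator `G^ε_K`. [cite: Balaban1982Higgs1, (3.67) p.625; (3.27) p.617] -/
theorem chiKA_eq_one_of_small (hK : K ≤ P.K) (hmu : 0 < mu0sq) (hak : 0 ≤ B1.aSeq a P.L K) (hc₀ : 0 ≤ c₀) (hc₁0 : 0 < c₁)
    (hc₁ : B1.aSeq a P.L K * (c₀ + 1 + mu0sq * c₀ * P.mesh K ^ 2 + B1.aSeq a P.L K * c₀) ≤ c₁)
    (hGv : ∀ (g : ScalarField P 0 P.d) (M : ℝ), (∀ x, ‖g x‖ ≤ M) →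
      ∀ x, ‖propagatorK (zeroCharge P.d) Finset.univ (0 : VecField P 0) mu0sq a K g x‖ ≤ c₀ * P.mesh K ^ 2 * M)
    {p : ℝ} {A : VecField P K} (hA : ∀ x, ‖toSite A x‖ ≤ c₁⁻¹ * thrF P.d (P.mesh K) p) :
    chiKA (P.mesh K) p mu0sq a K A = 1 := by
  have hv : toSite (bgVec (P := P) mu0sq a K A)
      = bgField (B1.aSeq a P.L K) (P.mesh K) (propagatorK (zeroCharge P.d) Finset.univ (0 : VecField P 0) mu0sq a K)
          (avgQkAdj (zeroCharge P.d) (0 : VecField P 0) K) (toSite A) := by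
    rw [toSite_bgVec]
    rfl
  show chiSmall P.d (P.mesh K) p (fun x => ‖toSite (bgVec (P := P) mu0sq a K A) x‖)
      (fun x => ‖negLap (toSite (bgVec (P := P) mu0sq a K A)) x‖) = 1
  rw [chiSmall_eq_one_iff]
  intro x
  rw [hv]
  have hA' : ∀ y, ‖toSite A y‖ ≤ c₁⁻¹ * P.mesh K ^ (-(((P.d : ℝ) - 2) / 2)) * p := fun y => by
    rw [mul_assoc]; exact hA y
  exact B1Ineq367Proof.chiK_of_small _ _ _ (P.mesh_pos K) hc₁0 (hreg_vec (c₁ := c₁) hK hmu hak hc₀ hc₁ hGv) hA' x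

/-- **`χ_K(φ) = 1` on the small-field set** ((3.28) for the scalar background field in the background `A^{(K),ε}`): if
`|φ(x)| ≦ c₁⁻¹ℓ^{−(d−2)/2}p` at every site, `c₁` as in `hreg_scalar`, then `χ_K(φ) = 1` (`B1Eq31Concrete.chiKφ`), GIVEN the
(2.25)-shaped bound for `G^ε_K(T_ε, A^{(K),ε})`. [cite: Balaban1982Higgs1, (3.67) p.625; (3.28) p.617] -/
theorem chiKφ_eq_one_of_small (hK : K ≤ P.K) (hmsq : 0 < msq) (hak : 0 ≤ B1.aSeq a P.L K) (hc₀ : 0 ≤ c₀) (hc₁0 : 0 < c₁)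
    (hc₁ : B1.aSeq a P.L K * (c₀ + 1 + msq * c₀ * P.mesh K ^ 2 + B1.aSeq a P.L K * c₀) ≤ c₁) {A : VecField P K}
    (hGs : ∀ (g : ScalarField P 0 N) (M : ℝ), (∀ x, ‖g x‖ ≤ M) →
      ∀ x, ‖propagatorK C Finset.univ (bgVec mu0sq a K A) msq a K g x‖ ≤ c₀ * P.mesh K ^ 2 * M)
    {p : ℝ} {φ : ScalarField P K N} (hφ : ∀ x, ‖φ x‖ ≤ c₁⁻¹ * thrF P.d (P.mesh K) p) :
    chiKφ C (P.mesh K) p mu0sq msq a K A φ = 1 := by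
  show chiSmall P.d (P.mesh K) p (fun x => ‖bgScalar C msq a K (bgVec mu0sq a K A) φ x‖)
      (fun x => ‖covLaplacianN C Finset.univ (bgVec mu0sq a K A) (bgScalar C msq a K (bgVec mu0sq a K A) φ) x‖) = 1
  rw [chiSmall_eq_one_iff]
  intro x
  have hφ' : ∀ y, ‖φ y‖ ≤ c₁⁻¹ * P.mesh K ^ (-(((P.d : ℝ) - 2) / 2)) * p := fun y => by
    rw [mul_assoc]; exact hφ y
  exact B1Ineq367Proof.chiK_of_small _ _ _ (P.mesh_pos K) hc₁0
    (hreg_scalar C (bgVec mu0sq a K A) (c₁ := c₁) hK hmsq hak hc₀ hc₁ hGs) hφ' x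

/-- **(3.67) FOR THE (Higgs)₂,₃ MODEL AT THE LAST LEVEL `K ≧ 1`: `χ_K(A)χ_K(φ) = 1` ON THE SMALL-FIELD SET `S_r`** — the
displayed input (E3) `hE3` of `B1Ineq368BoxBound.ineq368_model` / `B1LowerBound114Model.Inputs` VERBATIM (cut-off weight
`B1Ineq326HiggsModel.chiW` with thresholds `ℓ_K = L^Kε`, `p_K`; set `B1Ineq368BoxBound.smallSet`), for every radius
`r ≦ c₁⁻¹(L^Kε)^{−(d−2)/2}p_K` with any `c₁ ≧ a_K(c₀ + 1 + max{μ₀², m²}c₀(L^Kε)² + a_Kc₀)`, GIVEN the (2.25)-shaped sup bounds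
at level `K` of the vector propagator `G^ε_K` (`hGv`) and of the scalar propagators `G^ε_K(T_ε, A^{(K),ε})` for the `A` of the
small-field set (`hGs`) — Prop. 2.1, row B1.Prop2.1, displayed. [cite: Balaban1982Higgs1, (3.67) p.625; (3.27)–(3.29) p.617;
(2.25) p.610] -/
theorem chiW_eq_one_of_smallSet (ℓ p : ℕ → ℝ) (hK1 : 1 ≤ K) (hK : K ≤ P.K) (hmu : 0 < mu0sq) (hmsq : 0 < msq)
    (hak : 0 ≤ B1.aSeq a P.L K) (hc₀ : 0 ≤ c₀) (hc₁0 : 0 < c₁)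
    (hc₁v : B1.aSeq a P.L K * (c₀ + 1 + mu0sq * c₀ * P.mesh K ^ 2 + B1.aSeq a P.L K * c₀) ≤ c₁)
    (hc₁s : B1.aSeq a P.L K * (c₀ + 1 + msq * c₀ * P.mesh K ^ 2 + B1.aSeq a P.L K * c₀) ≤ c₁)
    (hℓK : ℓ K = P.mesh K) {r : ℝ} (hr : r ≤ c₁⁻¹ * thrF P.d (P.mesh K) (p K))
    (hGv : ∀ (g : ScalarField P 0 P.d) (M : ℝ), (∀ x, ‖g x‖ ≤ M) →
      ∀ x, ‖propagatorK (zeroCharge P.d) Finset.univ (0 : VecField P 0) mu0sq a K g x‖ ≤ c₀ * P.mesh K ^ 2 * M)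
    (hGs : ∀ A : VecField P K, (∀ x, ‖toSite A x‖ ≤ r) → ∀ (g : ScalarField P 0 N) (M : ℝ), (∀ x, ‖g x‖ ≤ M) →
      ∀ x, ‖propagatorK C Finset.univ (bgVec mu0sq a K A) msq a K g x‖ ≤ c₀ * P.mesh K ^ 2 * M) :
    ∀ ω ∈ smallSet P N K r, chiW C ℓ p mu0sq msq a K ω.1 ω.2 = 1 := by
  obtain ⟨K', rfl⟩ : ∃ K', K = K' + 1 := ⟨K - 1, by omega⟩
  rintro ⟨A, φ⟩ ⟨hA, hφ⟩
  show chiKA (ℓ (K' + 1)) (p (K' + 1)) mu0sq a (K' + 1) A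
      * chiKφ C (ℓ (K' + 1)) (p (K' + 1)) mu0sq msq a (K' + 1) A φ = 1
  rw [hℓK, chiKA_eq_one_of_small hK hmu hak hc₀ hc₁0 hc₁v hGv (fun x => (hA x).trans hr),
    chiKφ_eq_one_of_small C hK hmsq hak hc₀ hc₁0 hc₁s (hGs A hA) (fun x => (hφ x).trans hr), mul_one]

/-- **The constant `c₁` of (3.67) can be taken independent of `k, ε`** (p. 621/625): for `L > 1`, `a > 0`, `K ≧ 1`,
`L^Kε ≦ 1`, the `k, ε`-free choice `c₁ = a(c₀ + 1 + (μ₀² + m²)c₀ + ac₀)` satisfies both hypotheses `hc₁v`, `hc₁s` of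
`chiW_eq_one_of_smallSet` (`a_K ≦ a`, (2.15)). [cite: Balaban1982Higgs1, (3.67) p.625; (2.15) p.609] -/
theorem c₁_choice (hK1 : 1 ≤ K) (hL : 1 < (P.L : ℝ)) (ha : 0 < a) (hmu : 0 ≤ mu0sq) (hmsq : 0 ≤ msq) (hc₀ : 0 ≤ c₀)
    (hℓ : P.mesh K ≤ 1) :
    B1.aSeq a P.L K * (c₀ + 1 + mu0sq * c₀ * P.mesh K ^ 2 + B1.aSeq a P.L K * c₀)
        ≤ a * (c₀ + 1 + (mu0sq + msq) * c₀ + a * c₀) ∧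
      B1.aSeq a P.L K * (c₀ + 1 + msq * c₀ * P.mesh K ^ 2 + B1.aSeq a P.L K * c₀)
        ≤ a * (c₀ + 1 + (mu0sq + msq) * c₀ + a * c₀) := by
  have hak : B1.aSeq a P.L K ≤ a := B1.aSeq_le ha hL K hK1
  have hak0 : 0 ≤ B1.aSeq a P.L K := (B1.aSeq_pos ha hL hK1).le
  have hℓ2 : P.mesh K ^ 2 ≤ 1 := pow_le_one₀ (P.mesh_pos K).le hℓ
  have hmu2 : mu0sq * c₀ * P.mesh K ^ 2 ≤ (mu0sq + msq) * c₀ := by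
    calc mu0sq * c₀ * P.mesh K ^ 2 ≤ mu0sq * c₀ * 1 := mul_le_mul_of_nonneg_left hℓ2 (mul_nonneg hmu hc₀)
      _ ≤ (mu0sq + msq) * c₀ := by nlinarith [mul_nonneg hmsq hc₀]
  have hms2 : msq * c₀ * P.mesh K ^ 2 ≤ (mu0sq + msq) * c₀ := by
    calc msq * c₀ * P.mesh K ^ 2 ≤ msq * c₀ * 1 := mul_le_mul_of_nonneg_left hℓ2 (mul_nonneg hmsq hc₀)
      _ ≤ (mu0sq + msq) * c₀ := by nlinarith [mul_nonneg hmu hc₀]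
  have hac : B1.aSeq a P.L K * c₀ ≤ a * c₀ := mul_le_mul_of_nonneg_right hak hc₀
  constructor
  · exact mul_le_mul hak (by linarith) (by positivity) ha.le
  · exact mul_le_mul hak (by linarith) (by positivity) ha.le

end LevelK

end Literature.MathematicalPhysics.QuantumFieldTheory.Balaban1983to89.B1Ineq367SmallField
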